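import Summits.Ventures.PackingBounds.Configurations.E8Glue

/-!
# The glue system of a `D₄`-frame in a `240`-point kissing configuration of `ℝ⁸` (Bannai–Sloane, step (ii), part 5)

Framing: lottery ticket; floor = certified bounds/negative ranges. Venture `PackingBounds` (cell
`pub-packcert`, seat `pub-packcert-energy`).

Let `C ⊂ S⁷` be a kissing configuration with `|C| = 240` and `a, b, c, e ∈ C` a `D₄`-frame
(`d = (a+b+c+e)/2 ∈ C`). Write `P(a,b;c,e)` for the pattern class `⟨a,·⟩ = ⟨b,·⟩ = 1/2`, `⟨c,·⟩ = ⟨e,·⟩ = 0`.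
For `x' ∈ P(a,c;b,e)` and `y ∈ P(a,b;c,e)` Cauchy–Schwarz on the glue components gives `⟨x',y⟩ ∈ {0, 1/2}`
(`cross_inner_cases`), and replacing `y` by its partner `a + b - y ∈ C` switches the two values
(`partner_mem`). Hence (`exists_glue_system`) there are `y₁, …, y₄ ∈ P(a,b;c,e)` with pairwise inner products
`1/2` and `x' ∈ P(a,c;b,e)` with `⟨x',yᵢ⟩ = 1/2` for all `i` — the data from which `E8Coords.lean` builds an
orthonormal basis of `ℝ⁸` in which `C` has half-integral coordinates.

## References
* E. Bannai, N. J. A. Sloane, Canad. J. Math. 33 (1981) 437–449 (= Conway–Sloane, *SPLAG*, Ch. 14, Thm. 7–8). [`ConwaySloane1999`]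
-/

namespace Summit.Ventures.PackingBounds.Config.E8Basis

open Finset

section config

variable {C : Finset (EuclideanSpace ℝ (Fin 8))} (h1 : ∀ x ∈ C, ‖x‖ = 1)
  (h2 : ∀ x ∈ C, ∀ y ∈ C, x ≠ y → inner ℝ x y ≤ 1 / 2) (hcard : C.card = 240)
include h1 h2 hcard

/-- **Cross lemma.** For orthonormal `a, b, c ∈ C`, a point `x' ∈ C` with `⟨a,x'⟩ = ⟨c,x'⟩ = 1/2, ⟨b,x'⟩ = 0`
and a point `y ∈ C` with `⟨a,y⟩ = ⟨b,y⟩ = 1/2, ⟨c,y⟩ = 0` have `⟨x',y⟩ ∈ {0, 1/2}` (Cauchy–Schwarz for the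
glue components `x' - (a+c)/2`, `y - (a+b)/2` of norm² `1/2`, whose inner product is `⟨x',y⟩ - 1/4`). -/
theorem cross_inner_cases {a b c x' y : EuclideanSpace ℝ (Fin 8)} (ha : a ∈ C) (hb : b ∈ C) (hc : c ∈ C)
    (hab : inner ℝ a b = 0) (hac : inner ℝ a c = 0) (hbc : inner ℝ b c = 0)
    (hx' : x' ∈ C) (hax : inner ℝ a x' = 1 / 2) (hcx : inner ℝ c x' = 1 / 2) (hbx : inner ℝ b x' = 0)
    (hy : y ∈ C) (hay : inner ℝ a y = 1 / 2) (hby : inner ℝ b y = 1 / 2) (hcy : inner ℝ c y = 0) :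
    inner ℝ x' y = 0 ∨ inner ℝ x' y = 1 / 2 := by
  have haa : inner ℝ a a = 1 := by rw [real_inner_self_eq_norm_sq, h1 a ha, one_pow]
  have hbb : inner ℝ b b = 1 := by rw [real_inner_self_eq_norm_sq, h1 b hb, one_pow]
  have hcc : inner ℝ c c = 1 := by rw [real_inner_self_eq_norm_sq, h1 c hc, one_pow]
  have hxx : inner ℝ x' x' = 1 := by rw [real_inner_self_eq_norm_sq, h1 x' hx', one_pow]
  have hyy : inner ℝ y y = 1 := by rw [real_inner_self_eq_norm_sq, h1 y hy, one_pow]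
  have hba : inner ℝ b a = 0 := by rw [real_inner_comm]; exact hab
  have hca : inner ℝ c a = 0 := by rw [real_inner_comm]; exact hac
  have hcb : inner ℝ c b = 0 := by rw [real_inner_comm]; exact hbc
  have hxa : inner ℝ x' a = 1 / 2 := by rw [real_inner_comm]; exact hax
  have hxc : inner ℝ x' c = 1 / 2 := by rw [real_inner_comm]; exact hcx
  have hxb : inner ℝ x' b = 0 := by rw [real_inner_comm]; exact hbx
  have hya : inner ℝ y a = 1 / 2 := by rw [real_inner_comm]; exact hay
  have hyb : inner ℝ y b = 1 / 2 := by rw [real_inner_comm]; exact hby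
  have hyc : inner ℝ y c = 0 := by rw [real_inner_comm]; exact hcy
  have hne : x' ≠ y := by
    intro h; rw [h, hby] at hbx; norm_num at hbx
  set u : EuclideanSpace ℝ (Fin 8) := x' - (1 / 2 : ℝ) • (a + c) with hu
  set g : EuclideanSpace ℝ (Fin 8) := y - (1 / 2 : ℝ) • (a + b) with hg
  have hug : inner ℝ u g = inner ℝ x' y - 1 / 4 := by
    simp only [hu, hg, inner_sub_left, inner_sub_right, inner_smul_left, inner_smul_right,
      inner_add_left, inner_add_right, haa, hab, hca, hcb, hxa, hxb, hay, hcy,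
      RCLike.conj_to_real]
    ring
  have huu : inner ℝ u u = 1 / 2 := by
    simp only [hu, inner_sub_left, inner_sub_right, inner_smul_left, inner_smul_right,
      inner_add_left, inner_add_right, haa, hcc, hac, hca, hxa, hxc, hax, hcx, hxx, RCLike.conj_to_real]
    ring
  have hgg : inner ℝ g g = 1 / 2 := by
    simp only [hg, inner_sub_left, inner_sub_right, inner_smul_left, inner_smul_right,
      inner_add_left, inner_add_right, haa, hbb, hab, hba, hya, hyb, hay, hby, hyy, RCLike.conj_to_real]
    ring
  have hcs := real_inner_mul_inner_self_le u g
  rw [hug, huu, hgg] at hcs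
  rcases Kissing.kissing_dim8_inner_of_card_eq_240 C h1 h2 hcard hx' hy hne with h | h | h | h <;>
    (rw [h] at hcs ⊢) <;> first | (norm_num at hcs; done) | norm_num

/-- The partner `a + b - y` of a point `y` with `⟨a,y⟩ = ⟨b,y⟩ = 1/2` (`a ⊥ b` in `C`) lies in `C`. -/
theorem partner_mem {a b y : EuclideanSpace ℝ (Fin 8)} (ha : a ∈ C) (hb : b ∈ C) (hab : inner ℝ a b = 0)
    (hy : y ∈ C) (hay : inner ℝ a y = 1 / 2) (hby : inner ℝ b y = 1 / 2) : a + b - y ∈ C := by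
  have e1 : y - a ∈ C := E8Closure.sub_mem h1 h2 hcard hy ha (by rw [real_inner_comm]; exact hay)
  have e2 : y - a - b ∈ C :=
    E8Closure.sub_mem h1 h2 hcard e1 hb (by rw [inner_sub_left, real_inner_comm, hby, hab]; norm_num)
  have e3 := E8Closure.neg_mem h1 h2 hcard e2
  have : -(y - a - b) = a + b - y := by abel
  rw [this] at e3
  exact e3

/-- **Normalisation.** A point of `P(a,b;c,e)` or its partner has inner product `1/2` with `x'`. -/
theorem exists_normalized {a b c e x' y : EuclideanSpace ℝ (Fin 8)} (ha : a ∈ C) (hb : b ∈ C)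
    (hc : c ∈ C) (hab : inner ℝ a b = 0) (hac : inner ℝ a c = 0) (hae : inner ℝ a e = 0)
    (hbc : inner ℝ b c = 0) (hbe : inner ℝ b e = 0)
    (hx' : x' ∈ C) (hax : inner ℝ a x' = 1 / 2) (hcx : inner ℝ c x' = 1 / 2) (hbx : inner ℝ b x' = 0)
    (hy : y ∈ C) (hay : inner ℝ a y = 1 / 2) (hby : inner ℝ b y = 1 / 2) (hcy : inner ℝ c y = 0)
    (hey : inner ℝ e y = 0) :
    ∃ z ∈ C, (inner ℝ a z = 1 / 2 ∧ inner ℝ b z = 1 / 2 ∧ inner ℝ c z = 0 ∧ inner ℝ e z = 0) ∧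
      inner ℝ x' z = 1 / 2 ∧ (z = y ∨ z = a + b - y) := by
  rcases cross_inner_cases h1 h2 hcard ha hb hc hab hac hbc hx' hax hcx hbx hy hay hby hcy with h | h
  · have haa : inner ℝ a a = 1 := by rw [real_inner_self_eq_norm_sq, h1 a ha, one_pow]
    have hbb : inner ℝ b b = 1 := by rw [real_inner_self_eq_norm_sq, h1 b hb, one_pow]
    have hba : inner ℝ b a = 0 := by rw [real_inner_comm]; exact hab
    have hca : inner ℝ c a = 0 := by rw [real_inner_comm]; exact hac
    have hcb : inner ℝ c b = 0 := by rw [real_inner_comm]; exact hbc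
    have hea : inner ℝ e a = 0 := by rw [real_inner_comm]; exact hae
    have heb : inner ℝ e b = 0 := by rw [real_inner_comm]; exact hbe
    have hxa : inner ℝ x' a = 1 / 2 := by rw [real_inner_comm]; exact hax
    have hxb : inner ℝ x' b = 0 := by rw [real_inner_comm]; exact hbx
    refine ⟨a + b - y, partner_mem h1 h2 hcard ha hb hab hy hay hby, ⟨?_, ?_, ?_, ?_⟩, ?_, Or.inr rfl⟩
    · rw [inner_sub_right, inner_add_right, haa, hab, hay]; norm_num
    · rw [inner_sub_right, inner_add_right, hba, hbb, hby]; norm_num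
    · rw [inner_sub_right, inner_add_right, hca, hcb, hcy]; norm_num
    · rw [inner_sub_right, inner_add_right, hea, heb, hey]; norm_num
    · rw [inner_sub_right, inner_add_right, hxa, hxb, h]; norm_num
  · exact ⟨y, hy, ⟨hay, hby, hcy, hey⟩, h, Or.inl rfl⟩

omit h2 hcard in
/-- Inner product `1/2` between pattern points survives passing to partners. -/
theorem half_of_alt {a b y y' z z' : EuclideanSpace ℝ (Fin 8)} (ha : a ∈ C) (hb : b ∈ C)
    (hab : inner ℝ a b = 0) (hy : y ∈ C) (hy' : y' ∈ C)
    (hay : inner ℝ a y = 1 / 2) (hby : inner ℝ b y = 1 / 2)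
    (hay' : inner ℝ a y' = 1 / 2) (hby' : inner ℝ b y' = 1 / 2) (hyy' : inner ℝ y y' = 1 / 2)
    (hz : z = y ∨ z = a + b - y) (hz' : z' = y' ∨ z' = a + b - y') : inner ℝ z z' = 1 / 2 := by
  have haa : inner ℝ a a = 1 := by rw [real_inner_self_eq_norm_sq, h1 a ha, one_pow]
  have hbb : inner ℝ b b = 1 := by rw [real_inner_self_eq_norm_sq, h1 b hb, one_pow]
  have hyy : inner ℝ y y = 1 := by rw [real_inner_self_eq_norm_sq, h1 y hy, one_pow]
  have hy'y' : inner ℝ y' y' = 1 := by rw [real_inner_self_eq_norm_sq, h1 y' hy', one_pow]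
  have hba : inner ℝ b a = 0 := by rw [real_inner_comm]; exact hab
  have hya : inner ℝ y a = 1 / 2 := by rw [real_inner_comm]; exact hay
  have hyb : inner ℝ y b = 1 / 2 := by rw [real_inner_comm]; exact hby
  have hy'a : inner ℝ y' a = 1 / 2 := by rw [real_inner_comm]; exact hay'
  have hy'b : inner ℝ y' b = 1 / 2 := by rw [real_inner_comm]; exact hby'
  have hy'y : inner ℝ y' y = 1 / 2 := by rw [real_inner_comm]; exact hyy'
  rcases hz with rfl | rfl <;> rcases hz' with rfl | rfl
  · exact hyy'
  · rw [inner_sub_right, inner_add_right, hya, hyb, hyy']; norm_num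
  · rw [inner_sub_left, inner_add_left, hay', hby', hyy']; norm_num
  · simp only [inner_sub_left, inner_sub_right, inner_add_left, inner_add_right, haa, hbb, hab, hba,
      hya, hyb, hay', hby', hyy']
    norm_num

/-- **The glue system.** For a `D₄`-frame `a, b, c, e` (`d = (a+b+c+e)/2 ∈ C`) there are
`y₁, y₂, y₃, y₄ ∈ P(a,b;c,e)` with pairwise inner products `1/2` and `x' ∈ P(a,c;b,e)` with `⟨x',yᵢ⟩ = 1/2`.
[cite: ConwaySloane1999, Ch. 14 Thm. 7] -/
theorem exists_glue_system {a b c e d : EuclideanSpace ℝ (Fin 8)} (ha : a ∈ C) (hb : b ∈ C)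
    (hc : c ∈ C) (he : e ∈ C) (hd : d ∈ C)
    (hab : inner ℝ a b = 0) (hac : inner ℝ a c = 0) (hae : inner ℝ a e = 0) (hbc : inner ℝ b c = 0)
    (hbe : inner ℝ b e = 0) (hce : inner ℝ c e = 0) (hdsum : d = (1 / 2 : ℝ) • (a + b + c + e)) :
    ∃ y₁ ∈ C, ∃ y₂ ∈ C, ∃ y₃ ∈ C, ∃ y₄ ∈ C, ∃ x' ∈ C,
      (inner ℝ a y₁ = 1 / 2 ∧ inner ℝ b y₁ = 1 / 2 ∧ inner ℝ c y₁ = 0 ∧ inner ℝ e y₁ = 0) ∧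
      (inner ℝ a y₂ = 1 / 2 ∧ inner ℝ b y₂ = 1 / 2 ∧ inner ℝ c y₂ = 0 ∧ inner ℝ e y₂ = 0) ∧
      (inner ℝ a y₃ = 1 / 2 ∧ inner ℝ b y₃ = 1 / 2 ∧ inner ℝ c y₃ = 0 ∧ inner ℝ e y₃ = 0) ∧
      (inner ℝ a y₄ = 1 / 2 ∧ inner ℝ b y₄ = 1 / 2 ∧ inner ℝ c y₄ = 0 ∧ inner ℝ e y₄ = 0) ∧
      (inner ℝ a x' = 1 / 2 ∧ inner ℝ c x' = 1 / 2 ∧ inner ℝ b x' = 0 ∧ inner ℝ e x' = 0) ∧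
      (inner ℝ y₁ y₂ = 1 / 2 ∧ inner ℝ y₁ y₃ = 1 / 2 ∧ inner ℝ y₁ y₄ = 1 / 2 ∧
        inner ℝ y₂ y₃ = 1 / 2 ∧ inner ℝ y₂ y₄ = 1 / 2 ∧ inner ℝ y₃ y₄ = 1 / 2) ∧
      (inner ℝ x' y₁ = 1 / 2 ∧ inner ℝ x' y₂ = 1 / 2 ∧ inner ℝ x' y₃ = 1 / 2 ∧ inner ℝ x' y₄ = 1 / 2) := by
  classical
  obtain ⟨y₁, hy₁, y₂, hy₂, y₃, hy₃, y₄, hy₄, q₁, q₂, q₃, q₄, h12, h13, h14, h23, h24, h34⟩ :=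
    E8Glue.exists_four h1 h2 hcard ha hb hc he hd hab hac hae hbc hbe hce hdsum
  -- a point of the transposed pattern class `P(a,c;b,e)`
  have hcb : inner ℝ c b = 0 := by rw [real_inner_comm]; exact hbc
  have hdsum' : d = (1 / 2 : ℝ) • (a + c + b + e) := by rw [hdsum]; congr 1; abel
  have h8 := E8Glue.eight_le_card_pattern h1 h2 hcard ha hc hb he hd hac hab hae hcb hce hbe hdsum'
  have hne : (C.filter (fun y => inner ℝ a y = 1 / 2 ∧ inner ℝ c y = 1 / 2 ∧ inner ℝ b y = 0 ∧
      inner ℝ e y = 0)).Nonempty := by rw [← Finset.card_pos]; omega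
  obtain ⟨x', hx'⟩ := hne
  obtain ⟨hx'C, hax, hcx, hbx, hex⟩ := Finset.mem_filter.mp hx'
  -- normalise the four glue points against `x'`
  obtain ⟨z₁, hz₁, p₁, hx₁, alt₁⟩ := exists_normalized h1 h2 hcard ha hb hc hab hac hae hbc hbe hx'C hax
    hcx hbx hy₁ q₁.1 q₁.2.1 q₁.2.2.1 q₁.2.2.2
  obtain ⟨z₂, hz₂, p₂, hx₂, alt₂⟩ := exists_normalized h1 h2 hcard ha hb hc hab hac hae hbc hbe hx'C hax
    hcx hbx hy₂ q₂.1 q₂.2.1 q₂.2.2.1 q₂.2.2.2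
  obtain ⟨z₃, hz₃, p₃, hx₃, alt₃⟩ := exists_normalized h1 h2 hcard ha hb hc hab hac hae hbc hbe hx'C hax
    hcx hbx hy₃ q₃.1 q₃.2.1 q₃.2.2.1 q₃.2.2.2
  obtain ⟨z₄, hz₄, p₄, hx₄, alt₄⟩ := exists_normalized h1 h2 hcard ha hb hc hab hac hae hbc hbe hx'C hax
    hcx hbx hy₄ q₄.1 q₄.2.1 q₄.2.2.1 q₄.2.2.2
  refine ⟨z₁, hz₁, z₂, hz₂, z₃, hz₃, z₄, hz₄, x', hx'C, p₁, p₂, p₃, p₄, ⟨hax, hcx, hbx, hex⟩,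
    ⟨?_, ?_, ?_, ?_, ?_, ?_⟩, ⟨hx₁, hx₂, hx₃, hx₄⟩⟩
  · exact half_of_alt h1 ha hb hab hy₁ hy₂ q₁.1 q₁.2.1 q₂.1 q₂.2.1 h12 alt₁ alt₂
  · exact half_of_alt h1 ha hb hab hy₁ hy₃ q₁.1 q₁.2.1 q₃.1 q₃.2.1 h13 alt₁ alt₃
  · exact half_of_alt h1 ha hb hab hy₁ hy₄ q₁.1 q₁.2.1 q₄.1 q₄.2.1 h14 alt₁ alt₄
  · exact half_of_alt h1 ha hb hab hy₂ hy₃ q₂.1 q₂.2.1 q₃.1 q₃.2.1 h23 alt₂ alt₃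
  · exact half_of_alt h1 ha hb hab hy₂ hy₄ q₂.1 q₂.2.1 q₄.1 q₄.2.1 h24 alt₂ alt₄
  · exact half_of_alt h1 ha hb hab hy₃ hy₄ q₃.1 q₃.2.1 q₄.1 q₄.2.1 h34 alt₃ alt₄

end config

end Summit.Ventures.PackingBounds.Config.E8Basis
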